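import Summits.BirchSwinnertonDyer.BirchSwinnertonDyer.Theses.SignedBaseChange
import Literature.NumberTheory.EllipticCurves.CastellaWan2024.GreenbergMainConjectureBDP
import Literature.NumberTheory.EllipticCurves.CastellaHsuKunduLeeLiu2025.HeegnerPointMainConjectureSupersingularBDP
import Literature.NumberTheory.EllipticCurves.YanZhu2026.GreenbergMainTheoremsAnyRoot
import Literature.NumberTheory.EllipticCurves.PAdicGrossZagierConstantTermProofs
import Literature.NumberTheory.EllipticCurves.NonEisensteinPrimeOfSurjective
import Summits.BirchSwinnertonDyer.BirchSwinnertonDyer.Theorems.SignedBaseChangeAnticyclotomicEisensteinDivisibilityFrameConcordance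
import Summits.BirchSwinnertonDyer.Rank1Residual.X11b.RouteR1IntReceptacle
import Summits.BirchSwinnertonDyer.Rank1Residual.X11b.BDPRouteOpenInputDescent
import HarnessLib

/-! # Line `bdpline`, stub S1 `stub_bdpLowerHalfRatSS` ON THE SEMISTABLE-RAMIFIED CELL at `p ∤ h_K`:
# PRINT modulo ONE refereed named fact (Castella–Hsu–Kundu–Lee–Liu 2025 Thm. 7.1 / Cor. 7.2)

Crux `AnticyclotomicEisensteinDivisibility` (stmt-BirchSwinnertonDyer-20727, route `SignedBaseChange`), line
`bdpline` (skeleton v28 7f745f2e, lead bsd-line-sbc-p1 gen 6; this file = the lead's lane (6) for width seat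
bsd-line-sbc-p1-w7 gen 0). The registered research stub S1 `stub_bdpLowerHalfRatSS` = the RATIONAL Eisenstein
half of the BDP anticyclotomic main conjecture at a good supersingular `p ≥ 5`, `ρ̄` surjective, classical
Heegner `K`, ANY conductor, in EVERY BDP frame. The sibling `…BdpLowerHalfAdditive.lean` proves its text on
the ALL-ADDITIVE cell (Bertolini–Longo–Venerucci Hyp. 1.1 bullet 5, flag `BLV-step4-UNSOURCED-on-R4`); THIS
file proves it on the opposite cell — `N` SQUARE-FREE (every bad prime multiplicative) with `E[p]` RAMIFIED at
every `q ∣ N` — with the three extra binders `¬ p ∣ NumberField.classNumber K`, `Squarefree N`,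
"`∃` inertia element above each `q ∣ N` moving a `p`-torsion point" inserted after `κ₂.IsAnticyclotomic →`, from
the REFEREED named fact `CastellaHsuKunduLeeLiu2025.thm71_cor72_exists_isCWBDPLFunction_charIdeal_map_le_rat`
(Castella–Hsu–Kundu–Lee–Liu, *Derived p-adic heights and the leading coefficient of the
Bertolini–Darmon–Prasanna p-adic L-function*, Trans. AMS Ser. B 12 (2025) 748–788, doi:10.1090/btran/227, Thm. 7.1 / Cor. 7.2; bib `CastellaEtAl2025`; typed by the
lead in the currency of the BLV fact: same conclusion — a Castella–Wan frame and the rational inclusion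
`(p^k)·char_Λ(X_ac)·R₀⟦T⟧ ⊆ (L)` along every structure map) and the tree THEOREM
`SignedBaseChangeAcDivFrameConcordance.span_map_eq_of_isCWBDPLFunction_of_isBDPLFunction` (p634869: the
Castella–Wan frame and Castella 2018 Thm. 3.1's frame generate the same ideal of `𝒪_{ℂ_p}⟦T⟧`). The proof is
that of the sibling verbatim with the fact swapped.

So on the sub-cell {`N` square-free, `E[p]` ramified at every `q ∣ N`} × {`p ∤ h_K`} of the crux's
supersingular slice, S1 is PRINT modulo one refereed named fact. No summit statement is proved here; BSD /
the crux are NOT proved by this file.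
-/

-- D-0017: single-problem summit, the namespace repeats the problem name by design.
set_option linter.dupNamespace false
set_option autoImplicit false

noncomputable section

open scoped Classical NumberField

open NumberField IsDedekindDomain Field
  Literature.NumberTheory.EllipticCurves Literature.NumberTheory.EllipticCurves.ModularForms
  Literature.NumberTheory.EllipticCurves.Rank1Residual Literature.NumberTheory.EllipticCurves.Castella2018
  Literature.NumberTheory.EllipticCurves.CastellaWan2024 Literature.NumberTheory.GaloisRepresentations
  Literature.NumberTheory.EllipticCurves.YanZhu2026
  Summit.BirchSwinnertonDyer.Rank1Residual.X11b Summit.BirchSwinnertonDyer.Rank1Residual.X11b.Halves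
  Summit.BirchSwinnertonDyer.BirchSwinnertonDyer.Theorems

namespace Summit.BirchSwinnertonDyer.BirchSwinnertonDyer.Theorems.SignedBaseChangeAcDivBdpLowerHalfSemistable

open Summit.BirchSwinnertonDyer.BirchSwinnertonDyer.Theses.SignedBaseChange


/-- **S1 on the SEMISTABLE-RAMIFIED cell at `p ∤ h_K` (PRINT modulo ONE refereed named fact).** The
registered text of `stub_bdpLowerHalfRatSS` (line `bdpline`) with the binder `¬ p ∣ NumberField.classNumber K`
and the two binders `Squarefree N →` (every bad prime MULTIPLICATIVE) and "`E[p]` is RAMIFIED at every prime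
`q ∣ N`" (some inertia element above `q` moves some `p`-torsion point) inserted after `κ₂.IsAnticyclotomic →`,
from the named fact `CastellaHsuKunduLeeLiu2025.thm71_cor72_exists_isCWBDPLFunction_charIdeal_map_le_rat`
(Castella–Hsu–Kundu–Lee–Liu, Trans. AMS Ser. B 12 (2025), Thm. 7.1 / Cor. 7.2: the BDP main conjecture for
square-free `N` with `E[p]` ramified at every `q ∣ N`, `p ≥ 5` good supersingular split in the Heegner field
`K`, `p ∤ h_K` — typed by the lead as the Bertolini–Longo–Venerucci fact with its Hyp. 1.1 bullet 5 replaced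
by these two binders) and the frame concordance THEOREM of p634869.  Proof = that of
`SignedBaseChangeAcDivBdpLowerHalfAdditive.bdpLowerHalfRatSS_additive_of_BLV` verbatim with the fact swapped
(the fact's rational inclusion along `toUnr : ℤ_p → R₀` pushed to `𝒪_{ℂ_p}⟦T⟧` and moved to the given BDP
frame); the `Λ`-torsion hypothesis of the registered text is not used.
[cite: CastellaEtAl2025, Thm. 7.1 and Cor. 7.2 (arXiv:2308.10474v2 p0029)]
[cite: CastellaWan2023, Thm. 6.8 (MS pp. 29–31), Prop. 2.1 (MS pp. 5–6)] [cite: Castella2018, Thm. 3.1 and Def. 2.2] -/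
theorem bdpLowerHalfRatSS_semistable_of_CHKLL
    (hC : CastellaHsuKunduLeeLiu2025.thm71_cor72_exists_isCWBDPLFunction_charIdeal_map_le_rat) :
    SignedTwoVariableInputs → Literature.NumberTheory.EllipticCurves.ModularForms.nonempty_modularParametrizationData → ∀ (W : WeierstrassCurve ℚ) [W.IsElliptic] [W.IsGloballyMinimal] (p : ℕ) [Fact p.Prime], 5 ≤ p → W.HasGoodReductionAtPrime p → W.frobeniusTrace p = 0 → Literature.NumberTheory.EllipticCurves.Rank1Residual.Surj W p → ∀ (K : Type) [Field K] [NumberField K] (ι : PadicAlgCl p ≃+* ℂ) (v vbar : IsDedekindDomain.HeightOneSpectrum (NumberField.RingOfIntegers K)) (κ₁ κ₂ : Literature.NumberTheory.EllipticCurves.ZpExtension K p) (γ₁ γ₂ : Field.absoluteGaloisGroup K) [Fact (Literature.NumberTheory.EllipticCurves.ZpExtension.IsTopGeneratorPair κ₁ κ₂ γ₁ γ₂)] [NeZero (NumberField.discr K).natAbs] (N : ℕ) [NeZero N] (f : CuspForm (CongruenceSubgroup.Gamma0 N) 2), Literature.NumberTheory.EllipticCurves.ModularForms.IsNewformOf W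 f → (N : ℤ) = W.conductorNorm ℤ → Literature.NumberTheory.EllipticCurves.IsImaginaryQuadratic K → ((Ideal.span {(p : ℤ)}).primesOver (NumberField.RingOfIntegers K)).ncard = 2 → ((p : ℕ) : NumberField.RingOfIntegers K) ∈ v.asIdeal → ((p : ℕ) : NumberField.RingOfIntegers K) ∈ vbar.asIdeal → vbar ≠ v → (∀ (w : NumberField.InfinitePlace K) (k : NumberField.RingOfIntegers K), k ∈ v.asIdeal ↔ ‖ι.symm (w.embedding (k : K))‖ < 1) → IsCoprime (N : ℤ) (NumberField.discr K) → (∀ ℓ : ℕ, ℓ.Prime → ℓ ∣ N → ((Ideal.span {(ℓ : ℤ)}).primesOver (NumberField.RingOfIntegers K)).ncard = 2) → Odd (NumberField.discr K) → NumberField.discr K ≠ -3 → κ₁.IsCyclotomic → κ₂.IsAnticyclotomic → ¬ p ∣ NumberField.classNumber K → Squarefree N → (∀ q : ℕ, q.Prime → q ∣ N → ∃ v' : IsDedekindDomain.HeightOneSpectrum (NumberField.RingOfIntegers ℚ), ((q : ℕ) : NumberField.RingOfIntegers ℚ) ∈ v'.asIdeal ∧ ∃ 𝔓 ∈ v'.primesAbove,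 ∃ σ ∈ 𝔓.inertia (Field.absoluteGaloisGroup ℚ), ∃ P : W.geomTorsion (p : ℤ), σ • P ≠ P) → (haveI : Fact (κ₂.IsTopGenerator γ₂) := ⟨Literature.NumberTheory.EllipticCurves.YanZhu2026.isTopGenerator_of_pair (κ₁ := κ₁) (γ₁ := γ₁)⟩; Module.IsTorsion (Literature.NumberTheory.EllipticCurves.IwasawaAlgebra p) (Literature.NumberTheory.EllipticCurves.Castella2018.AcSelmer.XAc (W.baseChange K) p κ₂ vbar ∅ γ₂)) → ∀ (ΩK : ℂ) (Ωp' : (Literature.NumberTheory.EllipticCurves.unrIntegers p)ˣ) (L : Literature.NumberTheory.EllipticCurves.UnrSeries p), ΩK ≠ 0 → Literature.NumberTheory.EllipticCurves.IsBDPLFunction ι v κ₂ γ₂ f ΩK ((Ωp' : Literature.NumberTheory.EllipticCurves.unrIntegers p) : PadicComplex p) L → ∀ J : ℤ_[p] →+* PadicComplexInt p, (∀ x : ℤ_[p], ((J x : PadicComplexInt p) : PadicComplex p) = ((x : ℚ_[p]) : PadicComplex p)) → ∀ (J₀ : Literature.NumberTheory.EllipticCurves.unrIntegers p →+* PadicComplexInt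 p), (∀ x : Literature.NumberTheory.EllipticCurves.unrIntegers p, ((J₀ x : PadicComplexInt p) : PadicComplex p) = (x : PadicComplex p)) → ∃ k : ℕ, ∀ y ∈ (haveI : Fact (κ₂.IsTopGenerator γ₂) := ⟨Literature.NumberTheory.EllipticCurves.YanZhu2026.isTopGenerator_of_pair (κ₁ := κ₁) (γ₁ := γ₁)⟩; Literature.NumberTheory.EllipticCurves.Castella2018.AcSelmer.XAc.charIdeal (W.baseChange K) p κ₂ vbar ∅ γ₂).map (PowerSeries.map J), PowerSeries.C (((p : ℕ) : PadicComplexInt p) ^ k) * y ∈ Ideal.span {PowerSeries.map J₀ L} := by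
  intro hIn hmodP W _ _ p _ hp hgood ha0 hs K _ _ ι v vbar κ₁ κ₂ γ₁ γ₂ _ _ N _ f hf hN hK hsplit hv hvbar hvv hι hcop hHeeg hodd
    hne3 hκ₁ hκ₂ hh hsqf hram htors ΩK Ωp' L hΩK hL J hJ J₀ hJ₀
  haveI hγF : Fact (κ₂.IsTopGenerator γ₂) := ⟨isTopGenerator_of_pair (κ₁ := κ₁) (γ₁ := γ₁)⟩
  have hprime : p.Prime := Fact.out
  have hp2 : p ≠ 2 := by omega
  -- the named fact at `(ι, W, K, v, v̄, κ₂, γ₂, f)`: a Castella–Wan frame and the rational inclusion along `toUnr`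
  obtain ⟨ΩKw, Ωpw, LW, hΩKw, hLW, hk⟩ :=
    hC ι W K v vbar κ₂ γ₂ hf hN hp hgood ha0 hs hK hsplit hv hι hvbar hvv hHeeg hcop hh hsqf hram hκ₂
  obtain ⟨k, hkle⟩ := hk (toUnr p) (coe_toUnr p)
  -- the structure maps of S1 are the canonical ones (`𝒪_{ℂ_p} ↪ ℂ_p` is injective)
  have hJ₀eq : J₀ = R1.unrToCpInt p :=
    RingHom.ext fun x ↦ Subtype.ext ((hJ₀ x).trans (R1.coe_unrToCpInt p x).symm)
  subst hJ₀eq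
  have hJeq : J = R1.toCpInt p :=
    RingHom.ext fun x ↦ Subtype.ext ((hJ x).trans (R1.coe_toCpInt p x).symm)
  subst hJeq
  -- the two frames generate the same ideal of `𝒪_{ℂ_p}⟦T⟧` (width seat's concordance theorem)
  have hN' : (W.conductorNorm ℤ : ℕ) = N := by exact_mod_cast hN.symm
  have hpN : ¬ p ∣ N := by
    rw [← hN']
    exact not_dvd_conductorNorm_of_hasGoodReductionAtPrime W hgood
  have hpD : ¬ (p : ℤ) ∣ NumberField.discr K :=
    not_dvd_discr_of_ncard_primesOver hprime (by rw [hK.1]; exact hsplit)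
  have hconc : Ideal.span {PowerSeries.map (R1.unrToCpInt p) LW} =
      Ideal.span {PowerSeries.map (R1.unrToCpInt p) L} :=
    SignedBaseChangeAcDivFrameConcordance.span_map_eq_of_isCWBDPLFunction_of_isBDPLFunction hp2 hK hκ₂
      hγF.out hpN hpD hΩKw hΩK (coe_units_unrIntegers_ne_zero Ωpw) (coe_units_unrIntegers_ne_zero Ωp') hLW hL
  -- push the inclusion along `R₀ → 𝒪_{ℂ_p}`
  refine ⟨k, fun y hy ↦ ?_⟩
  have hmap := Ideal.map_mono (f := PowerSeries.map (R1.unrToCpInt p)) hkle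
  rw [Ideal.map_mul, Ideal.map_span, Set.image_singleton, Ideal.map_span, Set.image_singleton, Ideal.map_map,
    ← R1.map_toCpInt_eq_comp, PowerSeries.map_C, map_pow, map_natCast, hconc] at hmap
  exact hmap (Ideal.mul_mem_mul (Ideal.mem_span_singleton_self _) hy)

end Summit.BirchSwinnertonDyer.BirchSwinnertonDyer.Theorems.SignedBaseChangeAcDivBdpLowerHalfSemistable

end
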